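import Summits.BirchSwinnertonDyer.Rank1Residual.X11b.RouteOpenInputsAgree
import Summits.BirchSwinnertonDyer.Rank1Residual.X11b.RouteR1BDPValueCoreFrame
import Summits.BirchSwinnertonDyer.Rank1Residual.X11b.BDPRouteOpenInputFromLever
import Literature.NumberTheory.EllipticCurves.Castella2018.AnticyclotomicMainConjectureErratum
import Literature.NumberTheory.QuadraticFields.KroneckerSplitting
import HarnessLib

/-!
# Route `ErratumRoadFive`, crux `OpenInputIMC` (item stmt-BirchSwinnertonDyer-19061): the BRIDGE from
# the typed erratum fact (Castella erratum Thm. 1.1 = arXiv:2409.01360 Thm. 3.1, OPEN, p417695) to the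
# cell's currency — route R1's ∃-core shape `R1.IMCEqCoreFrameOnTree` on EVERY pair — and on to route
# p2's open input on `R1Population ∩ Locus` (+ THEOREM C♯) and on the SEMISTABLE part of
# `R1Population` (citation only)

Cell `bsd-stepL` (run/shared/lean/pub/bsd-stepL/), seat `bsd-stepL-imc-p1` (prover; D-0074 row A:
"Cas24 → FW21 Thm. 4.41 → `P2OpenInputOnTreeAt`"), `--supports stmt-BirchSwinnertonDyer-19061`;
companion of `Theorems/ErratumRoadFiveOpenInputIMCReduction.lean` (p417457, one-sided road),
`…EqualityRoad.lean` (p418026) and `…Split.lean` (p418364), and of the typer's Literature file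
`Castella2018/AnticyclotomicMainConjectureErratum.lean` (seat `bsd-stepL-imc-t1`, p417695).
HONEST FRAMING: the erratum fact is an explicitly labelled OPEN hypothesis (UNREFEREED: the erratum,
arXiv:2409.01360, and the load-bearing [FW21, Thm. 4.41]); every result below is CONDITIONAL on it
and on the published ∕ cited named facts it lists; nothing is asserted about any curve; BSD is proved
for no pair by this; the item is not closed by this. THEOREMS ONLY (no definition, no named fact, no
`sorry`).

## What this file proves

* §0 `ncard_primesOver_ne_two_of_dvd_discr` — a prime dividing `d_K` does not split in the quadratic
  field `K` (decomposition law; the erratum's "`q` nonsplit in `K`" at an erratum field, `q ∣ d_K`).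
* §1 **`imcEqCoreFrameOnTree_of_erratumThm11_OPEN`** — for EVERY globally minimal elliptic `W/ℚ` and
  prime `p`: the OPEN fact `Castella2018.erratumThm11_exists_isBDPLFunction_isTorsion_charIdeal_eq_OPEN`
  gives route R1's ∃-core shape H3∃⁻ = `R1.IMCEqCoreFrameOnTree W p` (a frame `(Ω_K ≠ 0, Ω_p ∈ R₀ˣ,
  L)` with Castella's interpolation property AND `Ch_Λ(X_ac^∅(E[p^∞]))·R₀⟦T⟧ = (L)` at every erratum
  datum). The datum's hypotheses discharge the fact's (i)–(iv): `5 ≤ p`; `Mult W p`; `Irr W p`; the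
  `β` of the Heegner datum; `p` splits and every `ℓ ∣ N`, `ℓ ≠ q`, splits on an erratum field; `q ∣ d_K`
  does not split (§0), so (iii) reads "`E` non-split multiplicative at `q` with `E[p]` ramified"; (ii)
  from the field's `2`-clause; (iv) from the A′-locus; `𝔭_{ι'}` is induced by `ι'` on the one infinite
  place. The Summits `X_ac` IS the Literature `X_ac` (`rfl`), and `toUnr` is THE structure map.
  Corollaries: H3∀′ (`R1.IMCEqAllFramesOnTree`), the one-sided core shape H3♭
  (`P2.IMCDivIntCoreFrameAtErratumData`, the input of p417457) — all on EVERY pair, from the fact alone.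
* §2 the crux's open input from the fact: on `R1Population ∩ Locus` given THEOREM C♯'s H2
  (`R1.BDPValueCoreFrameOnTree`; value rigidity moves the value to the fact's frame) and 9 + 5 named
  facts; on the SEMISTABLE part of `R1Population` (on or off the Locus) from NAMED FACTS ONLY (the OPEN
  fact + 11 published + 5 cited: `h32` supplies H2, `h23` the control identity) — i.e. there item 19061
  is DISCHARGEABLE BY CITATION modulo the unrefereed erratum; class-level forms for the planner's split.

Census of record (multr1-p1 `census500k`, X11b-shape pairs at `p ≥ 5`, `N < 5·10⁵`): `R1Population`
1 234 205 of 2 267 348, of which semistable 555 199; `R1Population ∩ Locus` 1 201 479.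
CONDITIONAL; nothing booked; no label changes; closes rung K2 of BirchSwinnertonDyer for NO pair.

References: [Castella2018Erratum] Thm. 1.1 (i)–(iv), §2, Thm. 2.3, (2.4), Thm. A′ (pp. 1–4); Castella
arXiv:2409.01360 Thm. 3.1 (PREPRINT); [FouquetWan2021] Thm. 4.41 (PREPRINT); [Castella2018] Def. 2.2,
Thms. 2.3, 3.1, 3.2, §5 (arXiv:1704.06608 pp. 5, 9, 12); [Castella2020JIMJ] §2.5; [JetchevSkinnerWan2017]
Thm. 3.3.1, §7.4.1; [Skinner2016PacificMC] Thm. C; [CaiShuTian2014] Thm. 1.1; [FriedbergHoffstein1995]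
Thm. B; [Mazur1978] Cor. 4.1; [Brink2007]; Marcus, *Number Fields*, Ch. 3 Thm. 25; [Miller2011LMS] Def. 1.1.
-/

set_option autoImplicit false

noncomputable section

open scoped Classical

open WeierstrassCurve NumberField IsDedekindDomain Field
open Literature.NumberTheory.EllipticCurves Literature.NumberTheory.EllipticCurves.GreenbergSelmer
open Literature.NumberTheory.EllipticCurves.ModularForms
open Literature.NumberTheory.EllipticCurves.Rank1Residual
open Literature.NumberTheory.EllipticCurves.Rank1Residual.Typed
open Literature.NumberTheory.EllipticCurves.Wuthrich2014
open Literature.NumberTheory.EllipticCurves.Castella2018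
open Literature.NumberTheory.GaloisRepresentations
open Literature.NumberTheory.GaloisCohomology
open Literature.NumberTheory.QuadraticFields.Quadratic
open Summit.BirchSwinnertonDyer.Rank1Residual Summit.BirchSwinnertonDyer.Rank1Residual.X11b
open Summit.BirchSwinnertonDyer.Rank1Residual.X11b.Halves

namespace Summit.BirchSwinnertonDyer.BirchSwinnertonDyer.Theorems

/-! ### §0 A prime dividing the discriminant does not split -/

section Split

variable {K : Type} [Field K] [NumberField K]

/-- **A prime `q ∣ d_K` does not split in the quadratic field `K`** (it ramifies): at odd `q` the
Legendre symbol `(d_K / q)` vanishes, so the decomposition law `ncard_primesOver_eq_two_iff_jacobiSym`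
excludes two primes above `q`; at `q = 2`, `2 ∣ d_K` excludes `d_K ≡ 1 (mod 8)`
(`ncard_primesOver_two_eq_two_iff`). Marcus, *Number Fields*, Ch. 3, Thm. 25. [folklore] -/
theorem ncard_primesOver_ne_two_of_dvd_discr (h2 : Module.finrank ℚ K = 2) {q : ℕ} (hq : q.Prime)
    (hqd : (q : ℤ) ∣ NumberField.discr K) :
    ((Ideal.span {(q : ℤ)}).primesOver (𝓞 K)).ncard ≠ 2 := by
  by_cases hq2 : q = 2
  · subst hq2
    have h8 := ncard_primesOver_two_eq_two_iff (K := K) h2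
    simp only [Nat.cast_ofNat] at hqd ⊢
    rw [Ne, h8]
    obtain ⟨k, hk⟩ := hqd
    omega
  · rw [Ne, ncard_primesOver_eq_two_iff_jacobiSym h2 hq hq2]
    have h0 : jacobiSym (NumberField.discr K) q = 0 := by
      rw [jacobiSym.eq_zero_iff]
      refine ⟨hq.ne_zero, ?_⟩
      have hg : (NumberField.discr K).gcd q = q := by
        rw [Int.gcd_eq_natAbs, Int.natAbs_natCast]
        exact Nat.gcd_eq_right (Int.natCast_dvd.mp hqd)
      rw [hg]
      exact hq.one_lt.ne'
    rw [h0]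
    decide

end Split

/-! ### §1 The erratum fact ⟹ route R1's ∃-core shape H3∃⁻ on EVERY pair -/

section Bridge

variable {W : WeierstrassCurve ℚ} [W.IsElliptic] [W.IsGloballyMinimal] {p : ℕ} [Fact p.Prime]

/-- **The Summits `Ch_Λ(X_ac^Σ)` IS the Literature one** (`X11b.AcSelmer.XAc.charIdeal`, multr1, vs
`Literature.…Castella2018.AcSelmer.XAc.charIdeal`, the re-homed construction the erratum fact is
stated on): the two unfold to the same term, `rfl` — companion of
`AcSelmer.hasCharValuationAt_iff_literature`. [cite: Castella2018, Def. 2.2 and Thm. 2.3 (arXiv:1704.06608 p. 5)] -/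
theorem AcSelmer.charIdeal_eq_literature {K : Type} [Field K] [NumberField K] (W' : WeierstrassCurve K)
    (p : ℕ) [Fact p.Prime] (κ : ZpExtension K p) (𝔭 : HeightOneSpectrum (𝓞 K))
    (S : Set (HeightOneSpectrum (𝓞 K))) (γ : Field.absoluteGaloisGroup K) [Fact (κ.IsTopGenerator γ)] :
    Summit.BirchSwinnertonDyer.Rank1Residual.X11b.AcSelmer.XAc.charIdeal W' p κ 𝔭 S γ =
      Literature.NumberTheory.EllipticCurves.Castella2018.AcSelmer.XAc.charIdeal W' p κ 𝔭 S γ := by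
  unfold Summit.BirchSwinnertonDyer.Rank1Residual.X11b.AcSelmer.XAc.charIdeal
    Literature.NumberTheory.EllipticCurves.Castella2018.AcSelmer.XAc.charIdeal
  rfl

/-- **THE BRIDGE: erratum Thm. 1.1 (typed, OPEN) ⟹ H3∃⁻ = `R1.IMCEqCoreFrameOnTree W p` on EVERY
pair.** At every erratum datum of `(W, p)` — A′-hypotheses `ErratumHypotheses W p` (`5 ≤ p`,
`mult(p)`, `irr(p)`, `E(ℚ_p)[p] = 0`), a non-split multiplicative `q ≠ p` with `E[p]` ramified, an
erratum field `K` for `q` (imaginary quadratic, `q ∣ d_K`, every other `ℓ ∣ N_E` split, the `2`-clause),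
a Heegner datum `H` of level `N_E` (its `β`: `d_K ≡ β² (mod 4N_E)`, i.e. `𝒪_K/𝔑 ≃ ℤ/N_Eℤ`), an
anticyclotomic `(κ, γ)`, an embedding datum `ι'` and the infinite place `w₀` — the hypotheses (i)–(iv)
of the erratum's Thm. 1.1 hold (§0 for "`q` nonsplit"; `thm11Hypotheses_of_isErratumField` is the
cell's earlier bookkeeping of the same), so the OPEN fact yields a frame `(Ω_K ≠ 0, Ω_p ∈ R₀ˣ, L)`
of `f_{Dt}` at `𝔭_{ι'}` with Castella's interpolation property and `Ch_Λ(X_ac^∅(E[p^∞]))·R₀⟦T⟧ = (L)`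
along THE structure map `toUnr` (`coe_toUnr`), on the Summits `X_ac` (= the Literature one, `rfl`).
No semistability, no A206, no H2. CONDITIONAL on the OPEN fact. [claim: Castella2018Erratum, status: under-review]
[cite: Castella2018, Def. 2.2 (p. 5), Thm. 3.1 (p. 9) (arXiv:1704.06608)]
[cite: Castella2020JIMJ, §2.5 (standing hypotheses at the tame level; carried as `Cas20Standing`, unused here)] -/
theorem imcEqCoreFrameOnTree_of_erratumThm11_OPEN
    (h11 : erratumThm11_exists_isBDPLFunction_isTorsion_charIdeal_eq_OPEN) :
    R1.IMCEqCoreFrameOnTree W p := by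
  intro _ q _ K _ _ Dt H w₀ P hE _hr hqp hmq hns hvq hK _hCas _hP _hc _hinf κ hκ γ _ ι' _e _he
  have h5 : 5 ≤ p := hE.1
  have hmult : Mult W p := hE.2.1
  have hirr : Irr W p := hE.2.2.1
  have htors : ∀ Q : (W.baseChange ℚ_[p]).toAffine.Point, p • Q = 0 → Q = 0 := hE.2.2.2.2
  have hpN : p ∣ W.conductorNorm ℤ := dvd_conductorNorm_of_mult hmult
  have hsplit : ((Ideal.span {(p : ℤ)}).primesOver (𝓞 K)).ncard = 2 :=
    hK.ncard_primesOver_eq_two Fact.out hpN hqp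
  have hHeeg : ∃ β : ℤ, (4 * (W.conductorNorm ℤ) : ℤ) ∣ β ^ 2 - NumberField.discr K :=
    ⟨H.β, H.dvd_sq_sub⟩
  have hnq : ((Ideal.span {(q : ℤ)}).primesOver (𝓞 K)).ncard ≠ 2 :=
    ncard_primesOver_ne_two_of_dvd_discr hK.1.1 Fact.out hK.2.1
  -- every multiplicative prime nonsplit in `K` is `q`
  have key : ∀ (ℓ : ℕ) [Fact ℓ.Prime], Mult W ℓ →
      ((Ideal.span {(ℓ : ℤ)}).primesOver (𝓞 K)).ncard ≠ 2 → ℓ = q := by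
    intro ℓ _ hℓ hnsℓ
    by_contra hne
    exact hnsℓ (hK.2.2.1 ℓ Fact.out (dvd_conductorNorm_of_mult hℓ) hne)
  -- (ii) if `2` is nonsplit then `2 ∥ N`
  have h2 : ((Ideal.span {(2 : ℤ)}).primesOver (𝓞 K)).ncard ≠ 2 → Mult W 2 := by
    intro h2ns
    by_cases h2N : 2 ∣ W.conductorNorm ℤ
    · by_cases h2q : (2 : ℕ) = q
      · haveI : Fact (Nat.Prime 2) := ⟨Nat.prime_two⟩
        subst h2q
        exact hmq
      · exact absurd (hK.2.2.1 2 Nat.prime_two h2N h2q) h2ns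
    · exact absurd (hK.2.2.2.1 h2N) h2ns
  -- (iii) nonsplit multiplicative at the nonsplit multiplicative primes (= `q`)
  have hns' : ∀ (ℓ : ℕ) [Fact ℓ.Prime], Mult W ℓ →
      ((Ideal.span {(ℓ : ℤ)}).primesOver (𝓞 K)).ncard ≠ 2 →
        ¬ W.HasSplitMultiplicativeReductionAtPrime ℓ := by
    intro ℓ _ hℓ hnsℓ
    obtain rfl := key ℓ hℓ hnsℓ
    exact hns
  have hram' : ∃ (ℓ : ℕ) (_ : Fact ℓ.Prime), Mult W ℓ ∧
      ((Ideal.span {(ℓ : ℤ)}).primesOver (𝓞 K)).ncard ≠ 2 ∧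
        ¬ p ∣ padicValInt ℓ W.minimalDiscriminantInt :=
    ⟨q, ‹_›, hmq, hnq, hvq⟩
  obtain ⟨ΩK, Ωp, L, hΩ, hL, -, hEq⟩ :=
    h11 ι' W K (primeOfEmbeddingDatum p ι' w₀.embedding) κ γ Dt.isNewformOf rfl (by omega) hmult
      hK.1 hHeeg hsplit (natCast_mem_primeOfEmbeddingDatum p ι' w₀.embedding)
      (forall_mem_primeOfEmbeddingDatum_iff p ι' hK.1 w₀) hirr h2 hns' hram' htors hκ
  refine ⟨ΩK, Ωp, L, hΩ, hL, ?_⟩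
  show (Summit.BirchSwinnertonDyer.Rank1Residual.X11b.AcSelmer.XAc.charIdeal (W.baseChange K) p κ
      (primeOfEmbeddingDatum p ι' w₀.embedding) ∅ γ).map (PowerSeries.map (toUnr p)) = Ideal.span {L}
  rw [AcSelmer.charIdeal_eq_literature]
  exact hEq (toUnr p) (coe_toUnr p)

/-- **Erratum Thm. 1.1 (typed, OPEN) ⟹ H3∀′ = `R1.IMCEqAllFramesOnTree W p` on EVERY pair** (the
equality at EVERY frame: ideal rigidity across periods, multr1-p1's
`R1.imcEqAllFramesOnTree_of_imcEqCoreFrame`). CONDITIONAL on the OPEN fact.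
[claim: Castella2018Erratum, status: under-review] [cite: Castella2018, Thm. 3.1 (arXiv:1704.06608 p. 9)] -/
theorem imcEqAllFramesOnTree_of_erratumThm11_OPEN
    (h11 : erratumThm11_exists_isBDPLFunction_isTorsion_charIdeal_eq_OPEN) :
    R1.IMCEqAllFramesOnTree W p :=
  R1.imcEqAllFramesOnTree_of_imcEqCoreFrame (imcEqCoreFrameOnTree_of_erratumThm11_OPEN h11)

omit [W.IsElliptic] in
/-- **Erratum Thm. 1.1 (typed, OPEN) ⟹ the ONE-SIDED core shape H3♭ =
`P2.IMCDivIntCoreFrameAtErratumData W p` on EVERY pair** — the input of p417457's one-sided reduction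
(read the `R₀`-frame in `𝓞_{ℂ_p}⟦T⟧`, keep one inclusion). CONDITIONAL on the OPEN fact.
[claim: Castella2018Erratum, status: under-review] [cite: Castella2018Erratum, (2.4) (p. 4)] -/
theorem imcDivIntCoreFrameAtErratumData_of_erratumThm11_OPEN [W.IsElliptic]
    (h11 : erratumThm11_exists_isBDPLFunction_isTorsion_charIdeal_eq_OPEN) :
    P2.IMCDivIntCoreFrameAtErratumData W p :=
  P2.imcDivIntCoreFrameAtErratumData_of_imcEqIntCoreFrame
    (R1.imcEqIntCoreFrameOnTree_of_imcEqCoreFrame (imcEqCoreFrameOnTree_of_erratumThm11_OPEN h11))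

end Bridge

/-! ### §2 The crux's open input from the erratum fact -/

section OpenInput

variable (W : WeierstrassCurve ℚ) [W.IsElliptic] [W.IsGloballyMinimal] (p : ℕ) [Fact p.Prime]

/-- **On `R1Population ∩ Locus`: the open input from the erratum fact + THEOREM C♯.** For a globally
minimal elliptic `W/ℚ` and a prime `p` with `R1Population W p`, `p ∤ ∏_ℓ c_ℓ(E)`:
`P2OpenInputOnTreeAt W p` from the OPEN erratum fact (`h11`), H2 = `R1.BDPValueCoreFrameOnTree W p`
(cell bsd-stepL THEOREM C♯ — the value at `𝟙`; on semistable `E` it is print, next theorem), NINE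
published named facts (`hGZ86 hGZK hSk hnf hCST hFH hMaz hGZ hKo`) and FIVE cited ones (`hPT hPT2 hEP
hcd hBr`). Proof: §1 gives H3∃⁻; route R1's equality record
`R1.bsdp_of_bdpValueCoreFrame_of_imcEqCoreFrame_record` gives `BSD(E,p)`; the control identity on the
Locus (`p2ControlOnTreeAt_of_locus`) and tightness (`P2.openInputOnTreeAt_of_bsdp_of_ram`) give the open
input at every classical datum. CONDITIONAL (OPEN fact, H2, named facts); nothing booked.
[claim: Castella2018Erratum, status: under-review]
[cite: Castella2018, Thm. 2.3 (p. 5), Thms. 3.1–3.2 (p. 9), §5 (p. 12) (arXiv:1704.06608)]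
[cite: JetchevSkinnerWan2017, Thm. 3.3.1 and §7.4.1 (arXiv:1512.06894 pp. 11, 30)] [cite: Miller2011LMS, Def. 1.1] -/
theorem openInputOnTreeAt_of_r1Population_of_not_dvd_of_bdpValueCoreFrame_of_erratumThm11_OPEN
    (h11 : erratumThm11_exists_isBDPLFunction_isTorsion_charIdeal_eq_OPEN)
    (hGZ86 : GrossZagier1986_thm_I_7_3) (hGZK : rank_eq_analyticRank_of_analyticRank_le_one)
    (hSk : Skinner2016.thmC_padicValRat_bsd_rank_zero) (hnf : exists_isNewformOf)
    (hCST : CaiShuTian2014.thm11_trivialChar)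
    (hFH : friedbergHoffstein_exists_twist_ne_zero_ramifiedAt)
    (hMaz : mazur_not_dvd_maninConstant_of_odd)
    (hGZ : ∀ (N : ℕ) [NeZero N] (W : WeierstrassCurve ℚ) (K : Type) [Field K] [NumberField K],
      gross_zagier N W K)
    (hKo : ∀ (N : ℕ) [NeZero N] (W : WeierstrassCurve ℚ) (K : Type) [Field K] [NumberField K],
      kolyvagin N W K)
    (hPT : ∀ (K : Type) [Field K] [NumberField K], poitouTate_selmerStructure_duality K)
    (hPT2 : ∀ (K : Type) [Field K] [NumberField K], poitouTate_sha_tateDual K)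
    (hEP : ∀ (K : Type) [Field K] [NumberField K] (v : HeightOneSpectrum (𝓞 K)),
      localEulerPoincareCharacteristic (v.adicCompletion K))
    (hcd : fieldCdLE_two_of_numberField)
    (hBr : ∀ (K : Type) [Field K] [NumberField K] (p : ℕ) [Fact p.Prime],
      ZpExtension.decomp_not_le_kerSubgroup_of_isAnticyclotomic K p)
    (h2 : R1.BDPValueCoreFrameOnTree W p)
    (hW : R1Population W p) (htam : ¬ p ∣ W.tamagawaProduct) : P2OpenInputOnTreeAt W p := by
  refine p2OpenInputOnTreeAt_of_imp (W := W) (p := p) fun hX _hp5 ↦ ?_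
  have hr : W.analyticRank = 1 := hX.1
  have hram : Ram W p := hW.1.ram
  have hbsd : BSDp W p :=
    R1.bsdp_of_bdpValueCoreFrame_of_imcEqCoreFrame_record hGZ86 hGZK hSk hnf hCST hFH hMaz hPT hPT2
      hEP hcd hBr h2 (imcEqCoreFrameOnTree_of_erratumThm11_OPEN h11) hW hr
  exact P2.openInputOnTreeAt_of_bsdp_of_ram W p hGZ hKo hSk hGZK
    (hasEntireLFunction_rat_of_exists_isNewformOf hnf)
    (p2ControlOnTreeAt_of_locus W p hKo hPT hPT2 hEP hcd hX hram htam) hram hbsd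

/-- **On the SEMISTABLE part of `R1Population` (on OR off the Locus): the open input BY CITATION.**
For a globally minimal SEMISTABLE elliptic `W/ℚ` and a prime `p` with `R1Population W p`:
`P2OpenInputOnTreeAt W p` from NAMED FACTS ONLY — the OPEN erratum fact (`h11`), ELEVEN published facts
(`hGZ86 hGZK hSk hnf hCST hFH hMaz hGZ hKo`, `h32` = Cas18 Thms. 3.1–3.2 supplying H2 on semistable
`E`, `h23` = Cas18 Thm. 2.3 supplying the control identity at `p ∣ N` without `p ∤ ∏c`) and FIVE cited
ones (`hPT hPT2 hEP hcd hBr`). On these pairs item 19061's statement is reduced to the unrefereed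
erratum and nothing else typed. CONDITIONAL (OPEN fact, named facts); nothing booked.
[claim: Castella2018Erratum, status: under-review]
[cite: Castella2018, Thm. 2.3 (p. 5), Thms. 3.1–3.2 (p. 9), §5 (p. 12) (arXiv:1704.06608)]
[cite: JetchevSkinnerWan2017, Thm. 3.3.1 and §7.4.1 (arXiv:1512.06894 pp. 11, 30)] [cite: Miller2011LMS, Def. 1.1] -/
theorem openInputOnTreeAt_of_r1Population_of_semistable_of_erratumThm11_OPEN
    (h11 : erratumThm11_exists_isBDPLFunction_isTorsion_charIdeal_eq_OPEN)
    (hGZ86 : GrossZagier1986_thm_I_7_3) (hGZK : rank_eq_analyticRank_of_analyticRank_le_one)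
    (hSk : Skinner2016.thmC_padicValRat_bsd_rank_zero) (hnf : exists_isNewformOf)
    (hCST : CaiShuTian2014.thm11_trivialChar)
    (hFH : friedbergHoffstein_exists_twist_ne_zero_ramifiedAt)
    (hMaz : mazur_not_dvd_maninConstant_of_odd)
    (h32 : thm32_exists_isBDPLFunction_valueAtOne) (h23 : thm23_anticyclotomicControl)
    (hGZ : ∀ (N : ℕ) [NeZero N] (W : WeierstrassCurve ℚ) (K : Type) [Field K] [NumberField K],
      gross_zagier N W K)
    (hKo : ∀ (N : ℕ) [NeZero N] (W : WeierstrassCurve ℚ) (K : Type) [Field K] [NumberField K],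
      kolyvagin N W K)
    (hPT : ∀ (K : Type) [Field K] [NumberField K], poitouTate_selmerStructure_duality K)
    (hPT2 : ∀ (K : Type) [Field K] [NumberField K], poitouTate_sha_tateDual K)
    (hEP : ∀ (K : Type) [Field K] [NumberField K] (v : HeightOneSpectrum (𝓞 K)),
      localEulerPoincareCharacteristic (v.adicCompletion K))
    (hcd : fieldCdLE_two_of_numberField)
    (hBr : ∀ (K : Type) [Field K] [NumberField K] (p : ℕ) [Fact p.Prime],
      ZpExtension.decomp_not_le_kerSubgroup_of_isAnticyclotomic K p)
    (hss : Semistable W) (hW : R1Population W p) : P2OpenInputOnTreeAt W p := by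
  refine p2OpenInputOnTreeAt_of_imp (W := W) (p := p) fun hX _hp5 ↦ ?_
  have hr : W.analyticRank = 1 := hX.1
  have hram : Ram W p := hW.1.ram
  have h2 : R1.BDPValueCoreFrameOnTree W p := R1.bdpValueCoreFrameOnTree_of_thm32 h32 hss
  have hbsd : BSDp W p :=
    R1.bsdp_of_bdpValueCoreFrame_of_imcEqCoreFrame_record hGZ86 hGZK hSk hnf hCST hFH hMaz hPT hPT2
      hEP hcd hBr h2 (imcEqCoreFrameOnTree_of_erratumThm11_OPEN h11) hW hr
  exact P2.openInputOnTreeAt_of_bsdp_of_ram W p hGZ hKo hSk hGZK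
    (hasEntireLFunction_rat_of_exists_isNewformOf hnf)
    (p2ControlOnTreeAt_of_thm23_of_semistable W p h23 hKo hss) hram hbsd

end OpenInput

/-! ### §3 Class-level forms for the planner's split of item 19061 -/

section ClassLevel

/-- **Child R (the `R1Population ∩ Locus` part of `OpenInputIMC`) from the erratum fact + H2 at every
pair** (class level; child R of p417457's split VERBATIM). CONDITIONAL; nothing booked.
[claim: Castella2018Erratum, status: under-review] [cite: Miller2011LMS, Def. 1.1] -/
theorem openInputIMC_r1Locus_of_bdpValueCoreFrame_of_erratumThm11_OPEN
    (h11 : erratumThm11_exists_isBDPLFunction_isTorsion_charIdeal_eq_OPEN)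
    (hGZ86 : GrossZagier1986_thm_I_7_3) (hGZK : rank_eq_analyticRank_of_analyticRank_le_one)
    (hSk : Skinner2016.thmC_padicValRat_bsd_rank_zero) (hnf : exists_isNewformOf)
    (hCST : CaiShuTian2014.thm11_trivialChar)
    (hFH : friedbergHoffstein_exists_twist_ne_zero_ramifiedAt)
    (hMaz : mazur_not_dvd_maninConstant_of_odd)
    (hGZ : ∀ (N : ℕ) [NeZero N] (W : WeierstrassCurve ℚ) (K : Type) [Field K] [NumberField K],
      gross_zagier N W K)
    (hKo : ∀ (N : ℕ) [NeZero N] (W : WeierstrassCurve ℚ) (K : Type) [Field K] [NumberField K],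
      kolyvagin N W K)
    (hPT : ∀ (K : Type) [Field K] [NumberField K], poitouTate_selmerStructure_duality K)
    (hPT2 : ∀ (K : Type) [Field K] [NumberField K], poitouTate_sha_tateDual K)
    (hEP : ∀ (K : Type) [Field K] [NumberField K] (v : HeightOneSpectrum (𝓞 K)),
      localEulerPoincareCharacteristic (v.adicCompletion K))
    (hcd : fieldCdLE_two_of_numberField)
    (hBr : ∀ (K : Type) [Field K] [NumberField K] (p : ℕ) [Fact p.Prime],
      ZpExtension.decomp_not_le_kerSubgroup_of_isAnticyclotomic K p)
    (h2 : ∀ (W : WeierstrassCurve ℚ) [W.IsElliptic] [W.IsGloballyMinimal] (p : ℕ) [Fact p.Prime],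
      R1.BDPValueCoreFrameOnTree W p) :
    ∀ (W : WeierstrassCurve ℚ) [W.IsElliptic] [W.IsGloballyMinimal] (p : ℕ) [Fact p.Prime],
      R1Population W p → ¬ p ∣ W.tamagawaProduct → P2OpenInputOnTreeAt W p :=
  fun W _ _ p _ hW htam ↦
    openInputOnTreeAt_of_r1Population_of_not_dvd_of_bdpValueCoreFrame_of_erratumThm11_OPEN W p h11
      hGZ86 hGZK hSk hnf hCST hFH hMaz hGZ hKo hPT hPT2 hEP hcd hBr (h2 W p) hW htam

/-- **The semistable part of `R1Population` (inside child R ∪ child ram′) BY CITATION** (class level):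
the crux holds at every SEMISTABLE pair of `R1Population`, from the OPEN erratum fact and 11 + 5 named
facts — nothing else typed. CONDITIONAL; nothing booked. [claim: Castella2018Erratum, status: under-review]
[cite: Castella2018, Thm. 2.3 (p. 5), Thms. 3.1–3.2 (p. 9) (arXiv:1704.06608)] [cite: Miller2011LMS, Def. 1.1] -/
theorem openInputIMC_r1Semistable_of_erratumThm11_OPEN
    (h11 : erratumThm11_exists_isBDPLFunction_isTorsion_charIdeal_eq_OPEN)
    (hGZ86 : GrossZagier1986_thm_I_7_3) (hGZK : rank_eq_analyticRank_of_analyticRank_le_one)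
    (hSk : Skinner2016.thmC_padicValRat_bsd_rank_zero) (hnf : exists_isNewformOf)
    (hCST : CaiShuTian2014.thm11_trivialChar)
    (hFH : friedbergHoffstein_exists_twist_ne_zero_ramifiedAt)
    (hMaz : mazur_not_dvd_maninConstant_of_odd)
    (h32 : thm32_exists_isBDPLFunction_valueAtOne) (h23 : thm23_anticyclotomicControl)
    (hGZ : ∀ (N : ℕ) [NeZero N] (W : WeierstrassCurve ℚ) (K : Type) [Field K] [NumberField K],
      gross_zagier N W K)
    (hKo : ∀ (N : ℕ) [NeZero N] (W : WeierstrassCurve ℚ) (K : Type) [Field K] [NumberField K],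
      kolyvagin N W K)
    (hPT : ∀ (K : Type) [Field K] [NumberField K], poitouTate_selmerStructure_duality K)
    (hPT2 : ∀ (K : Type) [Field K] [NumberField K], poitouTate_sha_tateDual K)
    (hEP : ∀ (K : Type) [Field K] [NumberField K] (v : HeightOneSpectrum (𝓞 K)),
      localEulerPoincareCharacteristic (v.adicCompletion K))
    (hcd : fieldCdLE_two_of_numberField)
    (hBr : ∀ (K : Type) [Field K] [NumberField K] (p : ℕ) [Fact p.Prime],
      ZpExtension.decomp_not_le_kerSubgroup_of_isAnticyclotomic K p) :
    ∀ (W : WeierstrassCurve ℚ) [W.IsElliptic] [W.IsGloballyMinimal] (p : ℕ) [Fact p.Prime],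
      Semistable W → R1Population W p → P2OpenInputOnTreeAt W p :=
  fun W _ _ p _ hss hW ↦
    openInputOnTreeAt_of_r1Population_of_semistable_of_erratumThm11_OPEN W p h11 hGZ86 hGZK hSk hnf
      hCST hFH hMaz h32 h23 hGZ hKo hPT hPT2 hEP hcd hBr hss hW

end ClassLevel

end Summit.BirchSwinnertonDyer.BirchSwinnertonDyer.Theorems

end
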